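import Literature.NumberTheory.GaloisRepresentations.LubinTateColemanRelativeLimitTwo
import Literature.NumberTheory.GaloisRepresentations.LubinTateUnramifiedRelativeZeros
import Literature.NumberTheory.GaloisRepresentations.LubinTateUnramifiedRelativeUnits
import HarnessLib

/-!
# Coleman's interpolation theorem over an unramified base (`q = 2`): de Shalit I §2.2 Theorem and Cor. 2.3 (ii) in the
# relative situation `k' = E ⊇ F = k`

De Shalit, *Iwasawa theory of elliptic curves with complex multiplication* (1987), Ch. I §2.2 **Theorem** (R. Coleman), for
the Lubin–Tate group of `f = πX + X²` of `F` (`|𝓀_F| = 2`) over a finite unramified base `E ⊆ F^{nr}` (normal over `F`),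
with Frobenius `φ` of `𝒪_E` (the restriction of an arithmetic Frobenius `σ₀ ∈ Γ_F`, `LubinTateUnramifiedFrobenius`): the
tower is `E·K_π^{m+1} = E ⊔ K_π^{m+1}` with the coherent generator `ω_{m+1}` (`cohPt`, `[π] ω_{m+2} = ω_{m+1}`); since
`φ(f) = f`, `(φ^{-i} f)(ω_i) = ω_{i-1}` is `f(ω_i) = ω_{i-1}` and the theorem reads: **for every NORM-COHERENT sequence
`β = (β_m)`, `β_m ∈ 𝒪_{E·K_π^{m+1}}^×` (`N_{E·K_π^{m+1}/E·K_π^{n+1}} β_m = β_n`), there is a unique `g ∈ 𝒪_E⟦X⟧` with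
`(φ^{-(m+1)} g)^ι(ω_{m+1}) = β_m` for all `m`, and `𝒩_E g = g^φ`** (Cor. 2.3 (ii)).  Everything PROVED (0 sorry, no named facts);
the proof is de Shalit's ((2)–(3) `LubinTateColemanRelativeEstimateTwo`, compactness of `𝒪_E`, uniqueness by
`LubinTateUnramifiedRelativeZeros`, units by `LubinTateUnramifiedRelativeUnits`):

* (compactness of `𝒪_E`, the Frobenius `frobUnitBall`, the limit and compactness steps: `LubinTateColemanRelativeLimitTwo`.)
* `IsRelNormCoherent β` — norm-coherence in the stabiliser-product form of `LubinTateColemanRelativeNormCoherentTwo`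
  (= Mathlib's `Algebra.norm` along the tower by `algebraMap_towerNorm_sup_eq_prod_relStab`).
* `exists_isUnit_evS_cohPt_eq` — every unit of `E·K_π^{m+1}` is `h^ι(ω_{m+1})`, `h(0) ∈ 𝒪_E^×` (via `σ_{u_m}`).
* ★★★ `exists_relColeman` — **existence**: `∃ g, ∀ m, ((φ⁻¹)^{m+1} g)^ι(ω_{m+1}) = β_m`;
  ★★ `relNormTwo_eq_map_frob_of_forall_evS_eq` — **Cor. 2.3 (ii): such a `g` satisfies `𝒩_E g = g^φ`**;
  ★★ `eq_of_forall_evS_symm_iterate_eq` — **uniqueness**.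

## References

* E. de Shalit, *Iwasawa theory of elliptic curves with complex multiplication* (1987), Ch. I §2.2 Theorem, Cor. 2.3 (ii). [deShalit1987]
* R. Coleman, *Division values in local fields*, Invent. Math. 53 (1979), Thm. A.

## Mathlib / tree reuse

`FiniteDimensional.proper`, `isCompact_closedBall`, `exists_clusterPt_of_compactSpace`, `mapClusterPt_iff_frequently`,
`Metric.closedBall_mem_nhds`, `IsUltrametricDist.dist_triangle_max`; tree: `norm_evS_symm_iterate_relNormTwo_iterate_sub_le`,
`norm_evS_map_sub_le_of_forall_lt`, `relNormTwo_map_iterate`, `symm_iterate_map_iterate` (Estimate), `prod_relStab_algEquiv_evS_cohPt`,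
`inclUnitBall_evS_map` (NormCoherent), `eq_zero_of_frequently_evS_map_map_eq_zero` (Zeros), `exists_isUnit_evS_inclPt_genPt_eq`
(Units), `relGalOfUnit`, `mapPt_relGalOfUnit_relAct` (Galois), `algEquiv_evS_map_inclUnitBall` (Product), `unitBallEquiv_*`
(UnramifiedFrobenius).
-/

noncomputable section

open Filter Topology
open scoped PowerSeries.WithPiTopology

namespace Literature.NumberTheory.GaloisRepresentations

section RelativeInterpolationTwo

open GaloisRepresentations.IsNonarchimedeanLocalField LubinTate ValuativeRel Field

-- universe 0 (`LubinTateUnramifiedRelativeUnits`)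
variable {F : Type} [Field F] [ValuativeRel F] [TopologicalSpace F] [IsNonarchimedeanLocalField F]

attribute [local instance] ltNormUniformSpace ltNormIsUniformAddGroup rk1 nF nE fintypeResidueField

variable {π : 𝒪[F]} (hπ : (valuation F).IsUniformizer (π : F))
variable (E : IntermediateField F (AlgebraicClosure F)) [FiniteDimensional F E] [Normal F E]

/-! ### Relative norm-coherence and unit series through `ω_{m+1}` -/

open scoped Classical in
/-- **Norm-coherence along `E·K_π^{m+1}`** in stabiliser-product form: for `n ≤ m` the product of `σ β_m` over
`{σ ∈ Aut_F(E·K_π^{m+1}) : σ|_E = id, σ(ι ω_{n+1}) = ι ω_{n+1}} = Gal(E·K_π^{m+1}/E·K_π^{n+1})` is `ι β_n` — i.e.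
`N_{E·K_π^{m+1}/E·K_π^{n+1}} β_m = β_n` (`algebraMap_towerNorm_sup_eq_prod_relStab`). [cite: deShalit1987, Ch. I §2.2 Theorem] -/
def IsRelNormCoherent (β : ∀ m : ℕ, unitBall (E ⊔ ltField π m : IntermediateField F (AlgebraicClosure F))) : Prop :=
  ∀ n m (hnm : n ≤ m),
    ∏ σ ∈ Finset.univ.filter (fun σ : (E ⊔ ltField π m : IntermediateField F (AlgebraicClosure F)) ≃ₐ[F]
        (E ⊔ ltField π m : IntermediateField F (AlgebraicClosure F)) =>
        (∀ x : E, σ (IntermediateField.inclusion le_sup_left x) = IntermediateField.inclusion le_sup_left x) ∧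
          mapPt σ (inclPt (sup_le_sup_left (ltField_mono hπ hnm) E)
              (inclPt (le_sup_right : ltField π n ≤ E ⊔ ltField π n) (cohPt hπ n))) =
            inclPt (sup_le_sup_left (ltField_mono hπ hnm) E)
              (inclPt (le_sup_right : ltField π n ≤ E ⊔ ltField π n) (cohPt hπ n))),
      σ ((β m : unitBall (E ⊔ ltField π m : IntermediateField F (AlgebraicClosure F))) :
        (E ⊔ ltField π m : IntermediateField F (AlgebraicClosure F))) =
      ((inclUnitBall (sup_le_sup_left (ltField_mono hπ hnm) E) (β n) :
        unitBall (E ⊔ ltField π m : IntermediateField F (AlgebraicClosure F))) :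
        (E ⊔ ltField π m : IntermediateField F (AlgebraicClosure F)))

include hπ in
/-- **Every unit `y` of `E·K_π^{m+1}` is `h^ι(ω_{m+1})` for some `h ∈ 𝒪_E⟦X⟧` with unit constant term** (at the coherent
generator `ω_{m+1} = [u_m]λ' = σ_{u_m} λ'`: take `h` through `λ'` with value `σ_{u_m}⁻¹ y`).
[cite: deShalit1987, Ch. I §2.2 Theorem (proof)] -/
theorem exists_isUnit_evS_cohPt_eq (hE : E ≤ maxUnramified F) (m : ℕ)
    (y : (E ⊔ ltField π m : IntermediateField F (AlgebraicClosure F))) (hy : ‖y‖ = 1) :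
    ∃ h : PowerSeries (unitBall E), IsUnit (PowerSeries.constantCoeff h) ∧
      ((evS (maxNilIdeal F (E ⊔ ltField π m : IntermediateField F (AlgebraicClosure F)))
          (inclPt (le_sup_right : ltField π m ≤ E ⊔ ltField π m) (cohPt hπ m))
          (PowerSeries.map (inclUnitBall (F := F) (le_sup_left : E ≤ E ⊔ ltField π m) :
            unitBall E →+* unitBall (E ⊔ ltField π m : IntermediateField F (AlgebraicClosure F))) h) :
          unitBall (E ⊔ ltField π m : IntermediateField F (AlgebraicClosure F))) :
          (E ⊔ ltField π m : IntermediateField F (AlgebraicClosure F))) = y := by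
  set σ := relGalOfUnit hπ E m hE (cohUnit hπ m) with hσ
  have hy' : ‖σ.symm y‖ = 1 := by rw [norm_algEquiv, hy]
  obtain ⟨h, hh, hval⟩ := exists_isUnit_evS_inclPt_genPt_eq hπ E hE m (σ.symm y) hy'
  refine ⟨h, hh, ?_⟩
  have hpt : inclPt (le_sup_right : ltField π m ≤ E ⊔ ltField π m) (cohPt hπ m) = mapPt σ (relGenPt hπ E m) := by
    rw [inclPt_cohPt_eq_relAct, hσ]
    conv_rhs => rw [← relAct_one hπ E m (relGenPt hπ E m)]
    rw [mapPt_relGalOfUnit_relAct, mul_one]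
  rw [hpt, ← algEquiv_evS_map_inclUnitBall (le_sup_left : E ≤ E ⊔ ltField π m) σ
    (relGalOfUnit_apply_inclusion hπ E m hE (cohUnit hπ m)) h (relGenPt hπ E m)]
  change σ _ = y
  rw [hval, AlgEquiv.apply_symm_apply]

/-! ### Existence -/

variable {E}

include hπ in
/-- ★★★ **Coleman's interpolation theorem over an unramified base, existence** (de Shalit I §2.2 Theorem, relative
situation, `q = 2`): `E ⊆ F^{nr}` finite normal, `σ₀ ∈ Γ_F` an arithmetic Frobenius with restriction `φ` to `𝒪_E`,
`β = (β_m)` units of `E·K_π^{m+1}` forming a norm-coherent sequence.  Then there is `g ∈ 𝒪_E⟦X⟧` with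
**`((φ⁻¹)^{m+1} g)^ι(ω_{m+1}) = β_m` for all `m`**. [cite: deShalit1987, Ch. I §2.2 Theorem] -/
theorem exists_relColeman (hq : residueFieldCard F = 2) (hE : E ≤ maxUnramified F)
    {σ₀ : absoluteGaloisGroup F} (hσ₀ : IsAbsArithFrob σ₀)
    (β : ∀ m : ℕ, unitBall (E ⊔ ltField π m : IntermediateField F (AlgebraicClosure F)))
    (hβ : ∀ m, ‖((β m : unitBall (E ⊔ ltField π m : IntermediateField F (AlgebraicClosure F))) :
      (E ⊔ ltField π m : IntermediateField F (AlgebraicClosure F)))‖ = 1)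
    (hcoh : IsRelNormCoherent hπ E β) :
    ∃ g : PowerSeries (unitBall E), ∀ m,
      evS (maxNilIdeal F (E ⊔ ltField π m : IntermediateField F (AlgebraicClosure F)))
        (inclPt (le_sup_right : ltField π m ≤ E ⊔ ltField π m) (cohPt hπ m))
        (PowerSeries.map (inclUnitBall (F := F) (le_sup_left : E ≤ E ⊔ ltField π m) :
          unitBall E →+* unitBall (E ⊔ ltField π m : IntermediateField F (AlgebraicClosure F)))
          ((PowerSeries.map ((frobUnitBall E σ₀).symm : unitBall E →+* unitBall E))^[m + 1] g)) = β m := by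
  set φ : unitBall E ≃+* unitBall E := frobUnitBall E σ₀ with hφ
  have hφπ : (φ : unitBall E →+* unitBall E) (algebraMap 𝒪[F] (unitBall E) π) = algebraMap 𝒪[F] (unitBall E) π :=
    frobUnitBall_algebraMap_pi E σ₀
  have hφ2 : ∀ c : unitBall E, (φ : unitBall E →+* unitBall E) c - c ^ 2 ∈ Ideal.span {algebraMap 𝒪[F] (unitBall E) π} :=
    frobUnitBall_sub_sq_mem hπ E hq hE hσ₀
  have hφsπ : (φ.symm : unitBall E →+* unitBall E) (algebraMap 𝒪[F] (unitBall E) π) = algebraMap 𝒪[F] (unitBall E) π :=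
    symm_algebraMap_pi E hφπ
  -- Step 1: unit series `h_m` with `h_m^ι(ω_{m+1}) = β_m`, and `g_m = 𝒩^{(m+1)} h_m`
  have hex : ∀ m, ∃ h : PowerSeries (unitBall E), IsUnit (PowerSeries.constantCoeff h) ∧
      ((evS (maxNilIdeal F (E ⊔ ltField π m : IntermediateField F (AlgebraicClosure F)))
          (inclPt (le_sup_right : ltField π m ≤ E ⊔ ltField π m) (cohPt hπ m))
          (PowerSeries.map (inclUnitBall (F := F) (le_sup_left : E ≤ E ⊔ ltField π m) :
            unitBall E →+* unitBall (E ⊔ ltField π m : IntermediateField F (AlgebraicClosure F))) h) :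
          unitBall (E ⊔ ltField π m : IntermediateField F (AlgebraicClosure F))) :
          (E ⊔ ltField π m : IntermediateField F (AlgebraicClosure F))) = β m :=
    fun m => exists_isUnit_evS_cohPt_eq hπ E hE m _ (hβ m)
  choose h hh1 hh2 using hex
  have hh2' : ∀ m, evS (maxNilIdeal F (E ⊔ ltField π m : IntermediateField F (AlgebraicClosure F)))
      (inclPt (le_sup_right : ltField π m ≤ E ⊔ ltField π m) (cohPt hπ m))
      (PowerSeries.map (inclUnitBall (F := F) (le_sup_left : E ≤ E ⊔ ltField π m) :
        unitBall E →+* unitBall (E ⊔ ltField π m : IntermediateField F (AlgebraicClosure F))) (h m)) = β m :=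
    fun m => Subtype.ext (hh2 m)
  set gs : ℕ → PowerSeries (unitBall E) := fun m => (relNormTwo hπ E hq)^[m + 1] (h m) with hgs
  -- Step 2: the key estimate `‖((φ⁻¹)^{n+1} g_m)^ι(ι ω_{n+1}) - ι β_n‖ ≤ ‖π‖^{m-n+1}` in `E·K_π^{m+1}`
  have hest : ∀ n m (hnm : n ≤ m),
      ‖((evS (maxNilIdeal F (E ⊔ ltField π m : IntermediateField F (AlgebraicClosure F)))
          (inclPt (sup_le_sup_left (ltField_mono hπ hnm) E)
            (inclPt (le_sup_right : ltField π n ≤ E ⊔ ltField π n) (cohPt hπ n)))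
          (PowerSeries.map (inclUnitBall (F := F) (le_sup_left : E ≤ E ⊔ ltField π m) :
            unitBall E →+* unitBall (E ⊔ ltField π m : IntermediateField F (AlgebraicClosure F)))
            ((PowerSeries.map (φ.symm : unitBall E →+* unitBall E))^[n + 1] (gs m))) :
          unitBall (E ⊔ ltField π m : IntermediateField F (AlgebraicClosure F))) :
          (E ⊔ ltField π m : IntermediateField F (AlgebraicClosure F))) -
        ((inclUnitBall (sup_le_sup_left (ltField_mono hπ hnm) E) (β n) :
          unitBall (E ⊔ ltField π m : IntermediateField F (AlgebraicClosure F))) :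
          (E ⊔ ltField π m : IntermediateField F (AlgebraicClosure F)))‖ ≤ ‖(π : F)‖ ^ (m - n + 1) := by
    intro n m hnm
    refine norm_evS_symm_iterate_relNormTwo_iterate_sub_le hπ E hq hE hφπ hφ2 (hh1 m) hnm ?_
    refine Eq.trans (Finset.prod_congr rfl fun σ _ => ?_) (hcoh n m hnm)
    exact congrArg (fun y : unitBall (E ⊔ ltField π m : IntermediateField F (AlgebraicClosure F)) =>
      σ (y : (E ⊔ ltField π m : IntermediateField F (AlgebraicClosure F)))) (hh2' m)
  -- Steps 3–4: compactness and the limit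
  exact exists_forall_evS_symm_iterate_eq_of_estimate hπ hE hφπ β gs hest

/-! ### `𝒩_E g = g^φ` (Cor. 2.3 (ii)) and uniqueness -/

omit [Normal F E] in
include hπ in
/-- ★★ **Uniqueness of the relative Coleman power series**: two series `g, g' ∈ 𝒪_E⟦X⟧` with
`((φ⁻¹)^{m+1} g)^ι(ω_{m+1}) = ((φ⁻¹)^{m+1} g')^ι(ω_{m+1})` for infinitely many `m` are equal (`σ` any `F`-automorphism of `E`,
e.g. the Frobenius). [cite: deShalit1987, Ch. I §2.2 Theorem (uniqueness)] -/
theorem eq_of_frequently_evS_symm_iterate_eq (hE : E ≤ maxUnramified F) (σ : E ≃ₐ[F] E) {g g' : PowerSeries (unitBall E)}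
    (hgg' : ∃ᶠ m in atTop,
      evS (maxNilIdeal F (E ⊔ ltField π m : IntermediateField F (AlgebraicClosure F)))
        (inclPt (le_sup_right : ltField π m ≤ E ⊔ ltField π m) (cohPt hπ m))
        (PowerSeries.map (inclUnitBall (F := F) (le_sup_left : E ≤ E ⊔ ltField π m) :
          unitBall E →+* unitBall (E ⊔ ltField π m : IntermediateField F (AlgebraicClosure F)))
          ((PowerSeries.map ((unitBallEquiv E σ).symm : unitBall E →+* unitBall E))^[m + 1] g)) =
      evS (maxNilIdeal F (E ⊔ ltField π m : IntermediateField F (AlgebraicClosure F)))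
        (inclPt (le_sup_right : ltField π m ≤ E ⊔ ltField π m) (cohPt hπ m))
        (PowerSeries.map (inclUnitBall (F := F) (le_sup_left : E ≤ E ⊔ ltField π m) :
          unitBall E →+* unitBall (E ⊔ ltField π m : IntermediateField F (AlgebraicClosure F)))
          ((PowerSeries.map ((unitBallEquiv E σ).symm : unitBall E →+* unitBall E))^[m + 1] g'))) :
    g = g' := by
  have hψπ : ((unitBallEquiv E σ).symm : unitBall E →+* unitBall E) (algebraMap 𝒪[F] (unitBall E) π) =
      algebraMap 𝒪[F] (unitBall E) π := symm_algebraMap_pi E (unitBallEquiv_algebraMap E σ π)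
  have hψn : ∀ c : unitBall E, ‖((((unitBallEquiv E σ).symm : unitBall E →+* unitBall E) c : unitBall E) : E)‖ = ‖(c : E)‖ :=
    fun c => norm_algEquiv σ.symm (c : E)
  refine eq_of_frequently_evS_map_map_eq hπ hE (fun m => ((unitBallEquiv E σ).symm : unitBall E →+* unitBall E) ^ (m + 1))
    (fun m => ringHom_pow_algebraMap_pi E hψπ (m + 1)) (fun m c => norm_ringHom_pow E hψn (m + 1) c)
    (fun m => (cohUnit hπ m : 𝒪[F])) (fun m => (cohUnit hπ m).isUnit) (hgg'.mono fun m hm => ?_)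
  have e1 := map_pow_eq_iterate E ((unitBallEquiv E σ).symm : unitBall E →+* unitBall E) (m + 1) g
  have e2 := map_pow_eq_iterate E ((unitBallEquiv E σ).symm : unitBall E →+* unitBall E) (m + 1) g'
  have e3 := cohPt_eq hπ m
  rw [e1, e2, ← e3]
  exact hm

set_option maxHeartbeats 400000 in
include hπ in
/-- ★★ **De Shalit's Cor. 2.3 (ii) over an unramified base: `𝒩_E g = g^φ`** for the interpolating series of a norm-coherent
`β` (`q = 2`): `(φ⁻¹)^{n+2}(𝒩_E g − g^φ)` vanishes at `ω_{n+1}` for every `n` (by (2) at `k = 1` and norm-coherence), hence is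
`0`. [cite: deShalit1987, Ch. I §2.3 (ii)] -/
theorem relNormTwo_eq_map_frob_of_forall_evS_eq (hq : residueFieldCard F = 2) (hE : E ≤ maxUnramified F)
    (σ₀ : absoluteGaloisGroup F)
    (β : ∀ m : ℕ, unitBall (E ⊔ ltField π m : IntermediateField F (AlgebraicClosure F)))
    (hcoh : IsRelNormCoherent hπ E β) {g : PowerSeries (unitBall E)}
    (hg : ∀ m, evS (maxNilIdeal F (E ⊔ ltField π m : IntermediateField F (AlgebraicClosure F)))
        (inclPt (le_sup_right : ltField π m ≤ E ⊔ ltField π m) (cohPt hπ m))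
        (PowerSeries.map (inclUnitBall (F := F) (le_sup_left : E ≤ E ⊔ ltField π m) :
          unitBall E →+* unitBall (E ⊔ ltField π m : IntermediateField F (AlgebraicClosure F)))
          ((PowerSeries.map ((frobUnitBall E σ₀).symm : unitBall E →+* unitBall E))^[m + 1] g)) = β m) :
    relNormTwo hπ E hq g = PowerSeries.map (frobUnitBall E σ₀ : unitBall E →+* unitBall E) g := by
  set φ : unitBall E ≃+* unitBall E := frobUnitBall E σ₀ with hφ
  have hφπ : (φ : unitBall E →+* unitBall E) (algebraMap 𝒪[F] (unitBall E) π) = algebraMap 𝒪[F] (unitBall E) π :=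
    frobUnitBall_algebraMap_pi E σ₀
  have hφsπ : (φ.symm : unitBall E →+* unitBall E) (algebraMap 𝒪[F] (unitBall E) π) = algebraMap 𝒪[F] (unitBall E) π :=
    symm_algebraMap_pi E hφπ
  have hφsn : ∀ c : unitBall E, ‖(((φ.symm : unitBall E →+* unitBall E) c : unitBall E) : E)‖ = ‖(c : E)‖ :=
    fun c => norm_algEquiv ((absoluteGaloisGroup.toAlgEquiv F σ₀).restrictNormal E).symm (c : E)
  rw [← sub_eq_zero]
  refine eq_zero_of_frequently_evS_map_map_eq_zero hπ hE (fun n => (φ.symm : unitBall E →+* unitBall E) ^ (n + 2))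
    (fun n => ringHom_pow_algebraMap_pi E hφsπ (n + 2)) (fun n c => norm_ringHom_pow E hφsn (n + 2) c)
    (fun n => (cohUnit hπ n : 𝒪[F])) (fun n => (cohUnit hπ n).isUnit) (Filter.Frequently.of_forall fun n => ?_)
  rw [← cohPt_eq]
  have hs : n ≤ n + 1 := Nat.le_succ n
  -- `(φ⁻¹)^{n+2}(𝒩 g − φ g) = 𝒩((φ⁻¹)^{n+2} g) − (φ⁻¹)^{n+1} g`
  have e1 : PowerSeries.map ((φ.symm : unitBall E →+* unitBall E) ^ (n + 2))
      (relNormTwo hπ E hq g - PowerSeries.map (φ : unitBall E →+* unitBall E) g) =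
      relNormTwo hπ E hq ((PowerSeries.map (φ.symm : unitBall E →+* unitBall E))^[n + 1 + 1] g) -
        (PowerSeries.map (φ.symm : unitBall E →+* unitBall E))^[n + 1] g := by
    rw [map_sub, map_pow_eq_iterate, ← relNormTwo_map_iterate hπ E hq hφsπ, show n + 2 = n + 1 + 1 by omega, pow_succ,
      RingHom.mul_def, PowerSeries.map_comp, RingHom.comp_apply, map_symm_map, map_pow_eq_iterate]
  rw [e1, map_sub, map_sub, sub_eq_zero]
  refine Eq.trans ?_ (hg n).symm
  apply inclUnitBall_injective (sup_le_sup_left (ltField_mono hπ hs) E)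
  have h2 := prod_relStab_algEquiv_evS_cohPt hπ E (n + 1) hE hq hs
    ((PowerSeries.map (φ.symm : unitBall E →+* unitBall E))^[n + 1 + 1] g)
  simp only [Nat.add_sub_cancel_left, Function.iterate_one] at h2
  apply Subtype.ext
  refine h2.symm.trans (Eq.trans ?_ (hcoh n (n + 1) hs))
  refine Finset.prod_congr rfl fun σ _ => ?_
  exact congrArg (fun y : unitBall (E ⊔ ltField π (n + 1) : IntermediateField F (AlgebraicClosure F)) =>
    σ (y : (E ⊔ ltField π (n + 1) : IntermediateField F (AlgebraicClosure F)))) (hg (n + 1))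

end RelativeInterpolationTwo

end Literature.NumberTheory.GaloisRepresentations
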